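import Literature.Topology.FourManifolds.LatticeFormsTransvections
import Literature.LinearAlgebra.Matrix.IntegerElementaryMatrices
import HarnessLib

/-!
# Two hyperbolic pairs: Eichler transvections as row and column operations (GHS 2009, Lemma 3.2)

Topic `Literature/Topology/FourManifolds`; sequel of `LatticeFormsTransvections.lean`, a step of
the algebraic half (Wall's generation theorem for `O(Q_N ⊕ H)`) of the proof architecture of
Kirby 1989 Ch. X Thm. 2 (`WallDiffeomorphisms.lean`), vendored from the open-access secondary
source V. Gritsenko, K. Hulek, G. K. Sankaran, *Abelianisation of orthogonal groups and the
fundamental group of modular varieties*, J. Algebra 322 (2009), §3 ("Eichler transvections and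
the Jacobi group"), whose Prop. 3.3 (iii) `O(L) = ⟨E_U(L₁), O(L₁)⟩` is "proved in [Wa] for
unimodular lattices", [Wa] = Wall, *On the orthogonal groups of unimodular quadratic forms II*
(1963) — the reference `[Wall4]` of Kirby's proof.

**Setting.** An integral symmetric bilinear module `(W, B)` with a hyperbolic pair `(x, y)`
(GHS's `U = ℤe ⊕ ℤf`, their `e, f` being our `y, x`) and, for the main result, a second
hyperbolic pair `(x₁, y₁)` orthogonal to it (`TwoHyperbolicPairs`; GHS's `U₁ = ℤe₁ ⊕ ℤf₁`
inside `L = U ⊕ U₁ ⊕ L₀` — only the four vectors are needed, not the splitting). The group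
`E_U` of GHS is generated by the Eichler transvections `E(y, a, q)`, `E(x, a, q)` with `a ⊥ U`
(`2q = a·a`); its elements are represented by words (`UGen`, `UGen.eval`, admissibility
`UGen.IsAdmissible`), as products of realised automorphisms are in
`WallDiffeomorphismsProofs.lean`; on `Q ⊕ H` these generators are Kirby's `A_a`, `A'_a`
(`LatticeFormsWallGenerators.lean`). Every `u ∈ W` has the coordinates `α = y·u`, `β = x·u`
(`U`-components) and `γ = y₁·u`, `δ = x₁·u` (`U₁`-components), arranged as GHS's matrix
`X(u) = [[γ, α], [β, -δ]]` (`ghsMatrix`; their identification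
`x e + x₁ e₁ + y₁ f₁ + y f ↦ [[x₁, x], [y, -y₁]]` of `U ⊕ U₁` with `M₂(ℤ)`, `q = -det`).

**Proved here** (GHS Lemma 3.2, second assertion, by its printed proof "from the representation
above and from the elementary divisor theorem for `2 × 2` matrices"):

* the four families `E(x, c x₁)`, `E(y, -c y₁)`, `E(x, -c y₁)`, `E(y, c x₁)` act on `X(u)` as
  the elementary row and column operations `X ↦ T₀₁(c) X`, `X ↦ T₁₀(c) X`, `X ↦ X T₀₁(c)`,
  `X ↦ X T₁₀(c)` (`ghsMatrix_rowGen`, `ghsMatrix_colGen`);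
* hence, by the diagonalisation of integer matrices by row and column transvections
  (`Literature.LinearAlgebra.Matrix.exists_list_transvec_mul_mul_list_transvec_eq_diagonal_int`,
  Euclid's algorithm), **every `u ∈ W` is moved by an admissible word to a vector orthogonal to
  `x` and `y`**, i.e. into `U^⊥ = U₁ ⊕ L₀` (`exists_uGens_ortho`): "For any `v ∈ U ⊕ U₁` there
  exists `g ∈ SO⁺(U ⊕ U₁)` such that `g(v) ∈ U₁`" (the `L₀`-component is carried along: the
  four families fix `⟨x, y, x₁, y₁⟩^⊥` pointwise).
* Bookkeeping: admissible words act by isometries (`UGen.map_eval`).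

Everything is proved; no named fact is introduced. NOT here: the first assertion of Lemma 3.2
(the four transvections generate all of `SO⁺(U ⊕ U₁)`), and Prop. 3.3 (i) itself (the Eichler
criterion), of which this is the first step.

## Sources

* V. Gritsenko, K. Hulek, G. K. Sankaran, *Abelianisation of orthogonal groups and the
  fundamental group of modular varieties*, J. Algebra 322 (2009) 463–478, arXiv:0810.1614, §3.2
  and Lemma 3.2. [GritsenkoHulekSankaran2009]
* W. A. Adkins, S. H. Weintraub, *Algebra*, GTM 136 (1992), Ch. 5, Remark 3.4 (diagonalisation
  by elementary operations over a Euclidean domain), through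
  `Literature/LinearAlgebra/Matrix/IntegerElementaryMatrices.lean`. [AdkinsWeintraub1992]
-/

noncomputable section

open Module Matrix
open LinearMap (BilinForm)

namespace Literature.Topology.FourManifolds

variable {W : Type*} [AddCommGroup W] (B : BilinForm ℤ W) (x y : W)

/-! ### Words in the transvections based at `x` and `y` -/

/-- A generator of GHS's group `E_U`: an Eichler transvection `E(y, a, q)` (`atY a q`) or
`E(x, a, q)` (`atX a q`) based at a vector of the hyperbolic pair `U = ⟨x, y⟩`; meaningful
(an isometry) when admissible (`UGen.IsAdmissible`: `a ⊥ U`, `a·a = 2q`).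
[cite: GritsenkoHulekSankaran2009, §3.3 (`E_U(L₁)`)] -/
inductive UGen (W : Type*)
  /-- `E(y, a, q)`. -/
  | atY (a : W) (q : ℤ)
  /-- `E(x, a, q)`. -/
  | atX (a : W) (q : ℤ)

namespace UGen

/-- The linear map of a generator. [cite: GritsenkoHulekSankaran2009, §3.3] -/
def toLinearMap : UGen W → (W →ₗ[ℤ] W)
  | atY a q => B.eichlerTransvection y a q
  | atX a q => B.eichlerTransvection x a q

/-- Admissibility of a generator `E(e, a, q)`, `e ∈ {x, y}`: `a ⊥ x`, `a ⊥ y`, `a·a = 2q` (then it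
is an isometry). [cite: GritsenkoHulekSankaran2009, §3.3] -/
def IsAdmissible : UGen W → Prop
  | atY a q => B x a = 0 ∧ B y a = 0 ∧ B a a = q + q
  | atX a q => B x a = 0 ∧ B y a = 0 ∧ B a a = q + q

/-- Evaluation of a word (the head is applied last), as a linear map. [folklore] -/
def eval (l : List (UGen W)) : W →ₗ[ℤ] W :=
  l.foldr (fun g f => g.toLinearMap B x y ∘ₗ f) LinearMap.id

/-- `eval [] = id`. [folklore] -/
@[simp] theorem eval_nil : eval B x y [] = LinearMap.id := rfl

/-- `eval (g :: l) = g ∘ eval l`. [folklore] -/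
@[simp] theorem eval_cons (g : UGen W) (l : List (UGen W)) :
    eval B x y (g :: l) = g.toLinearMap B x y ∘ₗ eval B x y l := rfl

/-- `eval (l ++ l') = eval l ∘ eval l'`. [folklore] -/
theorem eval_append (l l' : List (UGen W)) :
    eval B x y (l ++ l') = eval B x y l ∘ₗ eval B x y l' := by
  induction l with
  | nil => rfl
  | cons g l ih => rw [List.cons_append, eval_cons, eval_cons, ih, LinearMap.comp_assoc]

variable {B x y}

/-- An admissible generator is an isometry (`B` symmetric, `x`, `y` isotropic).
[cite: GritsenkoHulekSankaran2009, §3.1 (t2)] -/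
theorem map_toLinearMap (hB : B.IsSymm) (hxx : B x x = 0) (hyy : B y y = 0) {g : UGen W}
    (hg : g.IsAdmissible B x y) (v w : W) :
    B (g.toLinearMap B x y v) (g.toLinearMap B x y w) = B v w := by
  cases g with
  | atY a q =>
    obtain ⟨-, hya, hq⟩ := hg
    change B (B.eichlerTransvection y a q v) (B.eichlerTransvection y a q w) = B v w
    rw [B.map_eichlerTransvection hB hyy hya, hq, sub_self, mul_zero, add_zero]
  | atX a q =>
    obtain ⟨hxa, -, hq⟩ := hg
    change B (B.eichlerTransvection x a q v) (B.eichlerTransvection x a q w) = B v w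
    rw [B.map_eichlerTransvection hB hxx hxa, hq, sub_self, mul_zero, add_zero]

/-- An admissible word acts by an isometry. [cite: GritsenkoHulekSankaran2009, §3.1 (t2)] -/
theorem map_eval (hB : B.IsSymm) (hxx : B x x = 0) (hyy : B y y = 0) {l : List (UGen W)}
    (hl : ∀ g ∈ l, g.IsAdmissible B x y) (v w : W) :
    B (eval B x y l v) (eval B x y l w) = B v w := by
  induction l with
  | nil => rfl
  | cons g l ih =>
    rw [eval_cons, LinearMap.comp_apply, LinearMap.comp_apply,
      map_toLinearMap hB hxx hyy (hl g List.mem_cons_self),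
      ih fun g' hg' => hl g' (List.mem_cons_of_mem g hg')]

end UGen

/-! ### Two orthogonal hyperbolic pairs and the coordinate matrix -/

variable (x₁ y₁ : W)

/-- **Two orthogonal hyperbolic pairs** `(x, y)`, `(x₁, y₁)` in a symmetric integral bilinear
module: `x² = y² = x₁² = y₁² = 0`, `x·y = x₁·y₁ = 1`, and `⟨x, y⟩ ⊥ ⟨x₁, y₁⟩` (GHS's
`U ⊕ U₁ ⊆ L`, `U = ℤe ⊕ ℤf`, `U₁ = ℤe₁ ⊕ ℤf₁`). [cite: GritsenkoHulekSankaran2009, §3.2] -/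
structure TwoHyperbolicPairs : Prop where
  isSymm : B.IsSymm
  xx : B x x = 0
  yy : B y y = 0
  xy : B x y = 1
  x₁x₁ : B x₁ x₁ = 0
  y₁y₁ : B y₁ y₁ = 0
  x₁y₁ : B x₁ y₁ = 1
  xx₁ : B x x₁ = 0
  xy₁ : B x y₁ = 0
  yx₁ : B y x₁ = 0
  yy₁ : B y y₁ = 0

namespace TwoHyperbolicPairs

variable {B x y x₁ y₁} (h : TwoHyperbolicPairs B x y x₁ y₁)
include h

/-- `y·x = 1`. [folklore] -/
theorem yx : B y x = 1 := by rw [h.isSymm.eq, h.xy]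
/-- `y₁·x₁ = 1`. [folklore] -/
theorem y₁x₁ : B y₁ x₁ = 1 := by rw [h.isSymm.eq, h.x₁y₁]
/-- `x₁·x = 0`. [folklore] -/
theorem x₁x : B x₁ x = 0 := by rw [h.isSymm.eq, h.xx₁]
/-- `y₁·x = 0`. [folklore] -/
theorem y₁x : B y₁ x = 0 := by rw [h.isSymm.eq, h.xy₁]
/-- `x₁·y = 0`. [folklore] -/
theorem x₁y : B x₁ y = 0 := by rw [h.isSymm.eq, h.yx₁]
/-- `y₁·y = 0`. [folklore] -/
theorem y₁y : B y₁ y = 0 := by rw [h.isSymm.eq, h.yy₁]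

/-- `E(y, k x₁, 0)` and `E(x, k x₁, 0)` are admissible (`k x₁ ⊥ U`, `(k x₁)² = 0`). [folklore] -/
theorem isAdmissible_smul_x₁ (k : ℤ) :
    (UGen.atY (k • x₁) 0).IsAdmissible B x y ∧ (UGen.atX (k • x₁) 0).IsAdmissible B x y := by
  constructor <;> exact ⟨by simp [h.xx₁], by simp [h.yx₁], by simp [h.x₁x₁]⟩

/-- `E(y, k y₁, 0)` and `E(x, k y₁, 0)` are admissible (`k y₁ ⊥ U`, `(k y₁)² = 0`). [folklore] -/
theorem isAdmissible_smul_y₁ (k : ℤ) :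
    (UGen.atY (k • y₁) 0).IsAdmissible B x y ∧ (UGen.atX (k • y₁) 0).IsAdmissible B x y := by
  constructor <;> exact ⟨by simp [h.xy₁], by simp [h.yy₁], by simp [h.y₁y₁]⟩

end TwoHyperbolicPairs

/-- GHS's coordinate matrix `X(u) = [[γ, α], [β, -δ]]` of `u`, where `α = y·u`, `β = x·u` are
the `U`-coordinates and `γ = y₁·u`, `δ = x₁·u` the `U₁`-coordinates of `u` (the identification
`x e + x₁ e₁ + y₁ f₁ + y f ↦ [[x₁, x], [y, -y₁]]`, with `e, f, e₁, f₁ = y, x, y₁, x₁`).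
[cite: GritsenkoHulekSankaran2009, §3.2] -/
def ghsMatrix (u : W) : Matrix (Fin 2) (Fin 2) ℤ :=
  !![B y₁ u, B y u; B x u, -B x₁ u]

/-- Entry `(0,0)` of `X(u)` is `γ = y₁·u`. [folklore] -/
@[simp] theorem ghsMatrix_apply_00 (u : W) : ghsMatrix B x y x₁ y₁ u 0 0 = B y₁ u := rfl

/-- Entry `(0,1)` of `X(u)` is `α = y·u`. [folklore] -/
@[simp] theorem ghsMatrix_apply_01 (u : W) : ghsMatrix B x y x₁ y₁ u 0 1 = B y u := rfl

/-- Entry `(1,0)` of `X(u)` is `β = x·u`. [folklore] -/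
@[simp] theorem ghsMatrix_apply_10 (u : W) : ghsMatrix B x y x₁ y₁ u 1 0 = B x u := rfl

/-- Entry `(1,1)` of `X(u)` is `-δ = -(x₁·u)`. [folklore] -/
@[simp] theorem ghsMatrix_apply_11 (u : W) : ghsMatrix B x y x₁ y₁ u 1 1 = -B x₁ u := rfl

/-- The row operation of a transvection structure `t = (i, j, c)` on `Fin 2`: the generator
realising `X ↦ t.toMatrix * X` (`E(x, c x₁)` for `(i,j) = (0,1)`, `E(y, -c y₁)` for `(1,0)`).
[cite: GritsenkoHulekSankaran2009, Lemma 3.2] -/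
def rowGen (t : TransvectionStruct (Fin 2) ℤ) : UGen W :=
  if t.i = 0 then UGen.atX (t.c • x₁) 0 else UGen.atY (-t.c • y₁) 0

/-- The column operation of a transvection structure `t = (i, j, c)` on `Fin 2`: the generator
realising `X ↦ X * t.toMatrix` (`E(x, -c y₁)` for `(i,j) = (0,1)`, `E(y, c x₁)` for `(1,0)`).
[cite: GritsenkoHulekSankaran2009, Lemma 3.2] -/
def colGen (t : TransvectionStruct (Fin 2) ℤ) : UGen W :=
  if t.i = 0 then UGen.atX (-t.c • y₁) 0 else UGen.atY (t.c • x₁) 0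

/-! ### The four transvection families as row and column operations on `X(u)` -/

section RowCol

variable {B x y x₁ y₁} (h : TwoHyperbolicPairs B x y x₁ y₁)
include h

/-- `E(x, c x₁)` adds `c` times row `1` to row `0` of `X(u)`: `X(E(x, c x₁) u) = T₀₁(c) X(u)`.
[cite: GritsenkoHulekSankaran2009, Lemma 3.2] -/
theorem ghsMatrix_atX_smul_x₁ (c : ℤ) (u : W) :
    ghsMatrix B x y x₁ y₁ ((UGen.atX (c • x₁) 0).toLinearMap B x y u) =
      transvection 0 1 c * ghsMatrix B x y x₁ y₁ u := by
  ext a b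
  fin_cases a <;> fin_cases b <;>
    simp [ghsMatrix, UGen.toLinearMap, h.xx, h.yx, h.x₁x₁, h.y₁x₁, h.xx₁, h.yx₁, h.x₁x,
      h.y₁x, transvection, Matrix.mul_apply, Fin.sum_univ_two] <;> ring

/-- `E(y, -c y₁)` adds `c` times row `0` to row `1` of `X(u)`: `X(E(y, -c y₁) u) = T₁₀(c) X(u)`.
[cite: GritsenkoHulekSankaran2009, Lemma 3.2] -/
theorem ghsMatrix_atY_neg_smul_y₁ (c : ℤ) (u : W) :
    ghsMatrix B x y x₁ y₁ ((UGen.atY (-c • y₁) 0).toLinearMap B x y u) =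
      transvection 1 0 c * ghsMatrix B x y x₁ y₁ u := by
  ext a b
  fin_cases a <;> fin_cases b <;>
    simp [ghsMatrix, UGen.toLinearMap, h.yy, h.xy, h.y₁y₁, h.x₁y₁, h.xy₁, h.yy₁, h.x₁y,
      h.y₁y, transvection, Matrix.mul_apply, Fin.sum_univ_two] <;> ring

/-- `E(x, -c y₁)` adds `c` times column `0` to column `1` of `X(u)`:
`X(E(x, -c y₁) u) = X(u) T₀₁(c)`. [cite: GritsenkoHulekSankaran2009, Lemma 3.2] -/
theorem ghsMatrix_atX_neg_smul_y₁ (c : ℤ) (u : W) :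
    ghsMatrix B x y x₁ y₁ ((UGen.atX (-c • y₁) 0).toLinearMap B x y u) =
      ghsMatrix B x y x₁ y₁ u * transvection 0 1 c := by
  ext a b
  fin_cases a <;> fin_cases b <;>
    simp [ghsMatrix, UGen.toLinearMap, h.xx, h.yx, h.y₁y₁, h.x₁y₁, h.xy₁, h.yy₁, h.x₁x,
      h.y₁x, transvection, Matrix.mul_apply, Fin.sum_univ_two]
  ring

/-- `E(y, c x₁)` adds `c` times column `1` to column `0` of `X(u)`:
`X(E(y, c x₁) u) = X(u) T₁₀(c)`. [cite: GritsenkoHulekSankaran2009, Lemma 3.2] -/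
theorem ghsMatrix_atY_smul_x₁ (c : ℤ) (u : W) :
    ghsMatrix B x y x₁ y₁ ((UGen.atY (c • x₁) 0).toLinearMap B x y u) =
      ghsMatrix B x y x₁ y₁ u * transvection 1 0 c := by
  ext a b
  fin_cases a <;> fin_cases b <;>
    simp [ghsMatrix, UGen.toLinearMap, h.yy, h.xy, h.x₁x₁, h.y₁x₁, h.xx₁, h.yx₁, h.x₁y,
      h.y₁y, transvection, Matrix.mul_apply, Fin.sum_univ_two]
  ring

/-- Row generators are admissible. [folklore] -/
theorem isAdmissible_rowGen (t : TransvectionStruct (Fin 2) ℤ) :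
    (rowGen x₁ y₁ t).IsAdmissible B x y := by
  unfold rowGen
  split_ifs
  · exact (h.isAdmissible_smul_x₁ t.c).2
  · exact (h.isAdmissible_smul_y₁ (-t.c)).1

/-- Column generators are admissible. [folklore] -/
theorem isAdmissible_colGen (t : TransvectionStruct (Fin 2) ℤ) :
    (colGen x₁ y₁ t).IsAdmissible B x y := by
  unfold colGen
  split_ifs
  · exact (h.isAdmissible_smul_y₁ (-t.c)).2
  · exact (h.isAdmissible_smul_x₁ t.c).1

/-- `X(rowGen t u) = t.toMatrix * X(u)`. [cite: GritsenkoHulekSankaran2009, Lemma 3.2] -/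
theorem ghsMatrix_rowGen (t : TransvectionStruct (Fin 2) ℤ) (u : W) :
    ghsMatrix B x y x₁ y₁ ((rowGen x₁ y₁ t).toLinearMap B x y u) =
      t.toMatrix * ghsMatrix B x y x₁ y₁ u := by
  obtain ⟨i, j, hij, c⟩ := t
  fin_cases i <;> fin_cases j
  · exact absurd rfl hij
  · simpa [rowGen, TransvectionStruct.toMatrix] using ghsMatrix_atX_smul_x₁ h c u
  · simpa [rowGen, TransvectionStruct.toMatrix] using ghsMatrix_atY_neg_smul_y₁ h c u
  · exact absurd rfl hij

/-- `X(colGen t u) = X(u) * t.toMatrix`. [cite: GritsenkoHulekSankaran2009, Lemma 3.2] -/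
theorem ghsMatrix_colGen (t : TransvectionStruct (Fin 2) ℤ) (u : W) :
    ghsMatrix B x y x₁ y₁ ((colGen x₁ y₁ t).toLinearMap B x y u) =
      ghsMatrix B x y x₁ y₁ u * t.toMatrix := by
  obtain ⟨i, j, hij, c⟩ := t
  fin_cases i <;> fin_cases j
  · exact absurd rfl hij
  · simpa [colGen, TransvectionStruct.toMatrix] using ghsMatrix_atX_neg_smul_y₁ h c u
  · simpa [colGen, TransvectionStruct.toMatrix] using ghsMatrix_atY_smul_x₁ h c u
  · exact absurd rfl hij

/-- Words of row operations: `X(eval (L.map rowGen) u) = (L.map toMatrix).prod * X(u)`.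
[cite: GritsenkoHulekSankaran2009, Lemma 3.2] -/
theorem ghsMatrix_eval_map_rowGen (L : List (TransvectionStruct (Fin 2) ℤ)) (u : W) :
    ghsMatrix B x y x₁ y₁ (UGen.eval B x y (L.map (rowGen x₁ y₁)) u) =
      (L.map TransvectionStruct.toMatrix).prod * ghsMatrix B x y x₁ y₁ u := by
  induction L with
  | nil => simp
  | cons t L ih =>
    rw [List.map_cons, UGen.eval_cons, LinearMap.comp_apply, ghsMatrix_rowGen h, ih,
      List.map_cons, List.prod_cons, Matrix.mul_assoc]

/-- Words of column operations (applied head first, hence reversed):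
`X(eval (L.map colGen).reverse u) = X(u) * (L.map toMatrix).prod`.
[cite: GritsenkoHulekSankaran2009, Lemma 3.2] -/
theorem ghsMatrix_eval_reverse_map_colGen (L : List (TransvectionStruct (Fin 2) ℤ)) (u : W) :
    ghsMatrix B x y x₁ y₁ (UGen.eval B x y (L.map (colGen x₁ y₁)).reverse u) =
      ghsMatrix B x y x₁ y₁ u * (L.map TransvectionStruct.toMatrix).prod := by
  induction L generalizing u with
  | nil => simp
  | cons t L ih =>
    rw [List.map_cons, List.reverse_cons, UGen.eval_append, LinearMap.comp_apply,
      UGen.eval_cons, UGen.eval_nil, LinearMap.comp_id, ih, ghsMatrix_colGen h,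
      List.map_cons, List.prod_cons, Matrix.mul_assoc]

/-- **GHS Lemma 3.2 (second assertion): every vector is moved into `U^⊥` by the four
transvection families.** For every `u ∈ W` there is an admissible word `l` in the generators
`E(y, k x₁)`, `E(y, k y₁)`, `E(x, k x₁)`, `E(x, k y₁)` with `x · (l u) = 0` and `y · (l u) = 0`
("for any `v ∈ U ⊕ U₁` there exists `g` … such that `g(v) ∈ U₁`", the `L₀`-component being
carried along). Proof as printed: the generators act on `X(u)` by elementary row and column
operations, and an integer `2 × 2` matrix is diagonalised by such operations (elementary
divisor theorem; here `exists_list_transvec_mul_mul_list_transvec_eq_diagonal_int`), which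
kills the off-diagonal entries `α = y·u` and `β = x·u`.
[cite: GritsenkoHulekSankaran2009, Lemma 3.2] -/
theorem exists_uGens_ortho (u : W) :
    ∃ l : List (UGen W), (∀ g ∈ l, g.IsAdmissible B x y) ∧
      B x (UGen.eval B x y l u) = 0 ∧ B y (UGen.eval B x y l u) = 0 := by
  obtain ⟨L, L', D, hD⟩ :=
    Literature.LinearAlgebra.Matrix.exists_list_transvec_mul_mul_list_transvec_eq_diagonal_int
      (ghsMatrix B x y x₁ y₁ u)
  have hX : ghsMatrix B x y x₁ y₁ (UGen.eval B x y
      ((L'.map (colGen x₁ y₁)).reverse ++ L.map (rowGen x₁ y₁)) u) = diagonal D := by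
    rw [UGen.eval_append, LinearMap.comp_apply, ghsMatrix_eval_reverse_map_colGen h,
      ghsMatrix_eval_map_rowGen h, hD]
  refine ⟨(L'.map (colGen x₁ y₁)).reverse ++ L.map (rowGen x₁ y₁), fun g hg => ?_, ?_, ?_⟩
  · simp only [List.mem_append, List.mem_reverse, List.mem_map] at hg
    rcases hg with ⟨t, -, rfl⟩ | ⟨t, -, rfl⟩
    · exact isAdmissible_colGen h t
    · exact isAdmissible_rowGen h t
  · simpa using congrFun (congrFun hX 1) 0
  · simpa using congrFun (congrFun hX 0) 1

end RowCol

end Literature.Topology.FourManifolds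

end
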